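import Summits.ResolutionOfSingularities.ResolutionOfSingularities.Theorems.SyzygyFlatteningHigherRankTerminationLocAt
import Literature.AlgebraicGeometry.Resolution.ProperModelsFunctionField
import HarnessLib

/-!
# The local ring of a proper model at the centre of a valuation, inside `K` — `stub_centreChart`

Crux `SyzygyFlattening.Globalisation` (stmt-ResolutionOfSingularities-17061), line `birth`,
registered stub `stub_centreChart`: the dictionary "local ring of a proper model `M` of `K/k` at
the centre `x` of a valuation ring `𝒪_v`" ↔ "`k`-subalgebra of `K`" (Zariski–Samuel II, Ch. VI
§17: "if `P` is a point of a model `V` of `K/k`, the local ring `𝒪_P(V)` is a subring of `K`";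
the centre of `v` on a complete model is the point whose local ring `𝒪_v` dominates).

For a proper model `M` (`ProperModel k K`, `Literature/…/ProperModels.lean`), a point `x` and an
open `U` write (in this docstring only) `toK_x` for `𝒪_{M,x} → 𝒪_{M,ξ} = K(M) ≅ K`
(`(M.X.presheaf.stalkSpecializes (genericPoint_specializes x) ≫ M.funFieldIso.hom).hom`) and
`sec_U` for `Γ(M, U) → K(M) ≅ K` (germ at `ξ`, then `M.funFieldIso`); no definitions are
introduced — the registered statement is phrased with these raw composites, and so is every lemma.

* `centreChart_stalkToK_injective` — `toK_x` is injective (`K(M) = Frac 𝒪_{M,x}`);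
  `centreChart_specMap_stalkToK_fromSpecStalk`, `centreChart_eq_stalkToK_of_specMap_comp` —
  `toK_x` is THE morphism `u` with `Spec u ≫ (Spec 𝒪_{M,x} → M) = gen_M`;
* `centreChart_stalkToK_germ` — `toK_x ∘ germ_x = sec_U`;
* `centreChart_algebraMap_functionField_eq_germ`, `centreChart_secToK_algebraMap` — the
  transported `k`-algebra structure on `K(M)` is the geometric one, so `sec_U` maps the
  structure sections `k → Γ(M, ⊤) → Γ(M, U)` (`Scheme.Hom.appLE` of `M → Spec k`) to `k ⊆ K`;
  `centreChart_secAlgebraMap_finiteType` — `Γ(M, U)` is of finite type over `k` for affine `U`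
  (properness); hence `centreChart_exists_subalgebra` — the image `A = im sec_U` is (the subring
  of) a finitely generated `k`-subalgebra of `K` with `Frac A = K`
  (`functionField_isFractionRing_of_isAffineOpen`);
* for a lift `l : Spec 𝒪_v → M` of the `K`-point (`Spec K → Spec 𝒪_v → M = gen_M`) through
  `x = l(𝔪_v)`: the local homomorphism `𝒪_{M,x} → 𝒪_v` followed by `𝒪_v ⊆ K` is `toK_x`
  (`centreChart_stalkClosedPointTo_comp`), so `𝒪_{M,x} ⊆ 𝒪_v` inside `K`
  (`centreChart_stalkToK_mem_of_lift`), an element of `𝒪_{M,x}` is a unit iff its image is a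
  unit of `𝒪_v` (`centreChart_isUnit_of_lift`, `centreChart_inv_stalkToK_mem_of_isUnit`),
  `A ⊆ 𝒪_v` (`centreChart_secRange_le_of_lift`), and — since `𝒪_{M,x}` is the localisation of
  `Γ(M, U)` at the prime of `x` (`IsAffineOpen.isLocalization_stalk`) — the image of `𝒪_{M,x}`
  in `K` is `locAt 𝒪_v A`, the localisation of `A` at the centre `𝔪_v ∩ A` realised in `K`
  (`centreChart_locAt_toSubring_eq_of_lift`);
* `stub_centreChart` — the registered statement, at `x = M.centre v` with the lift provided by
  `ProperModel.isCentre_centre`.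

The projective-model analogue is `ProjectiveModelsCentresLocal.lean` (`ProjModel.stalkToK`, …),
from which the proofs are ported. All Zariski–Samuel II, Ch. VI §17.
-/

noncomputable section

-- single-problem summit: the doubled namespace component `ResolutionOfSingularities` is forced
set_option linter.dupNamespace false

namespace Summit.ResolutionOfSingularities.ResolutionOfSingularities.Theorems.SyzygyFlattening

open CategoryTheory AlgebraicGeometry TopologicalSpace IsLocalRing
open Literature.AlgebraicGeometry.Resolution

universe u

section Model

variable {k K : Type u} [Field k] [Field K] [Algebra k K]

/-! ## `𝒪_{M,x} → K` -/

/-- **`𝒪_{M,x} → K(M) ≅ K` is injective** (`K(M) = Frac 𝒪_{M,x}` for the integral scheme `M`;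
Zariski–Samuel II, Ch. VI §17: the local ring of a point of a model is a subring of `K`).
[cite: ZariskiSamuel1960, Ch. VI §17] -/
theorem centreChart_stalkToK_injective (M : ProperModel k K) (x : M.X) :
    Function.Injective
      ((M.X.presheaf.stalkSpecializes (genericPoint_specializes x) ≫ M.funFieldIso.hom).hom) :=
  M.funFieldIso.commRingCatIsoToRingEquiv.injective.comp
    (IsFractionRing.injective (M.X.presheaf.stalk x) M.X.functionField)

/-- **`Spec K → Spec 𝒪_{M,x} → M` is the `K`-point `gen_M`.** [folklore] -/
theorem centreChart_specMap_stalkToK_fromSpecStalk (M : ProperModel k K) (x : M.X) :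
    Spec.map (M.X.presheaf.stalkSpecializes (genericPoint_specializes x) ≫ M.funFieldIso.hom) ≫
      M.X.fromSpecStalk x = M.gen := by
  rw [Spec.map_comp, Category.assoc, Scheme.SpecMap_stalkSpecializes_fromSpecStalk,
    ProperModel.specMap_funFieldIso_hom_fromSpecStalk]

/-- **A morphism `u : 𝒪_{M,x} → K` with `Spec u ≫ (Spec 𝒪_{M,x} → M) = gen_M` IS
`𝒪_{M,x} → K(M) ≅ K`** (`Spec 𝒪_{M,x} → M` is a monomorphism). [folklore] -/
theorem centreChart_eq_stalkToK_of_specMap_comp {M : ProperModel k K} {x : M.X}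
    (u : M.X.presheaf.stalk x ⟶ CommRingCat.of K)
    (hu : Spec.map u ≫ M.X.fromSpecStalk x = M.gen) :
    u = M.X.presheaf.stalkSpecializes (genericPoint_specializes x) ≫ M.funFieldIso.hom := by
  -- adapted from `ProjModel.eq_stalkToK_of_specMap_comp` (ProjectiveModelsCentresLocal.lean)
  apply Spec.map_injective
  rw [← cancel_mono (M.X.fromSpecStalk x), hu, centreChart_specMap_stalkToK_fromSpecStalk]

/-! ## Sections of an open: `Γ(M, U) → K` and the structure map `k → Γ(M, U)` -/

/-- The generic point of a proper model lies in every open containing a point. [folklore] -/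
theorem centreChart_genericPoint_mem {M : ProperModel k K} {U : M.X.Opens} {x : M.X}
    (hx : x ∈ U) : genericPoint M.X ∈ U :=
  (genericPoint_specializes x).mem_open U.isOpen hx

/-- `𝒪_{M,x} → K` extends `Γ(M, U) → K` (germ at the generic point, read in `K`) along the
germ map at `x ∈ U`. [folklore] -/
theorem centreChart_stalkToK_germ (M : ProperModel k K) {U : M.X.Opens} {x : M.X} (hx : x ∈ U)
    (f : Γ(M.X, U)) :
    (M.X.presheaf.stalkSpecializes (genericPoint_specializes x) ≫ M.funFieldIso.hom).hom
        ((M.X.presheaf.germ U x hx).hom f) =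
      (M.X.presheaf.germ U (genericPoint M.X) (centreChart_genericPoint_mem hx) ≫
        M.funFieldIso.hom).hom f := by
  change ((M.X.presheaf.germ U x hx ≫
    M.X.presheaf.stalkSpecializes (genericPoint_specializes x)) ≫ M.funFieldIso.hom).hom f = _
  rw [TopCat.Presheaf.germ_stalkSpecializes]

/-- The `k`-algebra structure on `K(M)` of `ProperModelsFunctionField` (transported from `K`)
is the geometric one `k = Γ(Spec k) → Γ(M, 𝒪) → K(M)`: both induce `Spec K(M) → M → Spec k`.
[folklore] -/
theorem centreChart_algebraMap_functionField_eq_germ (M : ProperModel k K) :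
    algebraMap k M.X.functionField =
      (M.X.presheaf.germ ⊤ (genericPoint M.X) trivial).hom.comp
        (M.π.appTop.hom.comp (Scheme.ΓSpecIso (.of k)).inv.hom) := by
  -- adapted from `ProjModel.algebraMap_functionField_eq_germ` (ProjectiveModelsCentresLocal.lean)
  set ψ₀ : k →+* M.X.functionField := (M.X.presheaf.germ ⊤ (genericPoint M.X) trivial).hom.comp
    (M.π.appTop.hom.comp (Scheme.ΓSpecIso (.of k)).inv.hom) with hψ₀
  have e1 : (Spec (CommRingCat.of k)).toSpecΓ ≫ Spec.map (Scheme.ΓSpecIso (.of k)).inv = 𝟙 _ := by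
    rw [← SpecMap_ΓSpecIso_hom, ← Spec.map_comp, Iso.inv_hom_id, Spec.map_id]
  have h1 : Spec.map (CommRingCat.ofHom ψ₀) = M.X.fromSpecStalk (genericPoint M.X) ≫ M.π := by
    calc Spec.map (CommRingCat.ofHom ψ₀)
        = Spec.map (M.X.presheaf.germ ⊤ (genericPoint M.X) trivial) ≫ Spec.map M.π.appTop ≫
            Spec.map (Scheme.ΓSpecIso (.of k)).inv := by
          rw [hψ₀, show CommRingCat.ofHom ((M.X.presheaf.germ ⊤ (genericPoint M.X) trivial).hom.comp
              (M.π.appTop.hom.comp (Scheme.ΓSpecIso (.of k)).inv.hom)) =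
            (Scheme.ΓSpecIso (.of k)).inv ≫ M.π.appTop ≫
              M.X.presheaf.germ ⊤ (genericPoint M.X) trivial from rfl,
            Spec.map_comp, Spec.map_comp, Category.assoc]
      _ = M.X.fromSpecStalk (genericPoint M.X) ≫ M.X.toSpecΓ ≫ Spec.map M.π.appTop ≫
            Spec.map (Scheme.ΓSpecIso (.of k)).inv := by rw [Scheme.fromSpecStalk_toSpecΓ_assoc]
      _ = M.X.fromSpecStalk (genericPoint M.X) ≫ M.π ≫ (Spec (CommRingCat.of k)).toSpecΓ ≫
            Spec.map (Scheme.ΓSpecIso (.of k)).inv := by rw [Scheme.toSpecΓ_naturality_assoc M.π]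
      _ = M.X.fromSpecStalk (genericPoint M.X) ≫ M.π := by rw [e1, Category.comp_id]
  rw [M.fromSpecStalk_genericPoint_π] at h1
  have h2 := Spec.map_injective h1
  exact (congrArg CommRingCat.Hom.hom h2).symm

/-- **`Γ(M, U)` is a finitely generated `k`-algebra** for an affine open `U` of a proper model,
for the structure map `k = Γ(Spec k) → Γ(M, ⊤) → Γ(M, U)` (`M → Spec k` is locally of finite
type). [folklore] -/
theorem centreChart_secAlgebraMap_finiteType (M : ProperModel k K) {U : M.X.Opens}
    (hU : IsAffineOpen U) :
    ((M.π.appLE ⊤ U le_top).hom.comp (Scheme.ΓSpecIso (.of k)).inv.hom).FiniteType := by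
  have h1 : (M.π.appLE ⊤ U le_top).hom.FiniteType :=
    HasRingHomProperty.appLE @LocallyOfFiniteType M.π inferInstance ⟨⊤, isAffineOpen_top _⟩
      ⟨U, hU⟩ le_top
  exact h1.comp (RingHom.FiniteType.of_surjective _
    (Scheme.ΓSpecIso (.of k)).symm.commRingCatIsoToRingEquiv.surjective)

/-- **Compatibility of `Γ(M, U) → K` with the structure maps**: the image in `K` of the
structure section `c ∈ k → Γ(M, U)` is `c ∈ k ⊆ K`. [folklore] -/
theorem centreChart_secToK_algebraMap (M : ProperModel k K) (U : M.X.Opens)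
    (hU' : genericPoint M.X ∈ U) (c : k) :
    (M.X.presheaf.germ U (genericPoint M.X) hU' ≫ M.funFieldIso.hom).hom
        ((M.π.appLE ⊤ U le_top).hom ((Scheme.ΓSpecIso (.of k)).inv.hom c)) =
      algebraMap k K c := by
  rw [← M.funFieldIso_hom_algebraMap c, centreChart_algebraMap_functionField_eq_germ]
  change M.funFieldIso.hom.hom ((M.X.presheaf.germ U (genericPoint M.X) hU').hom
      ((M.X.presheaf.map (homOfLE (le_top : U ≤ ⊤)).op).hom
        (M.π.appTop.hom ((Scheme.ΓSpecIso (.of k)).inv.hom c)))) =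
    M.funFieldIso.hom.hom ((M.X.presheaf.germ ⊤ (genericPoint M.X) trivial).hom
      (M.π.appTop.hom ((Scheme.ΓSpecIso (.of k)).inv.hom c)))
  rw [TopCat.Presheaf.germ_res_apply]

/-! ## The chart `A = im (Γ(M, U) → K)` -/

/-- **The affine coordinate ring of an affine chart `U` inside `K`**: the image `A` of
`Γ(M, U) → K(M) ≅ K` is (the subring of) a finitely generated `k`-subalgebra of `K` (image of
the finitely generated `k`-algebra `Γ(M, U)`) with `Frac A = K` (`K(M) = Frac Γ(M, U)`).
[cite: ZariskiSamuel1960, Ch. VI §17] -/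
theorem centreChart_exists_subalgebra (M : ProperModel k K) {U : M.X.Opens} (hU : IsAffineOpen U)
    (hU' : genericPoint M.X ∈ U) :
    ∃ A : Subalgebra k K,
      A.toSubring = (M.X.presheaf.germ U (genericPoint M.X) hU' ≫ M.funFieldIso.hom).hom.range ∧
        A.FG ∧ IsFractionRing ↥A K := by
  set sec := (M.X.presheaf.germ U (genericPoint M.X) hU' ≫ M.funFieldIso.hom).hom with hsec
  letI : Algebra k Γ(M.X, U) :=
    ((M.π.appLE ⊤ U le_top).hom.comp (Scheme.ΓSpecIso (.of k)).inv.hom).toAlgebra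
  haveI hft : Algebra.FiniteType k Γ(M.X, U) := centreChart_secAlgebraMap_finiteType M hU
  let φ : Γ(M.X, U) →ₐ[k] K :=
    { sec with commutes' := fun c => centreChart_secToK_algebraMap M U hU' c }
  refine ⟨φ.range, ?_, ?_, ?_⟩
  · refine SetLike.ext fun z => ?_
    rw [Subalgebra.mem_toSubring, AlgHom.mem_range, RingHom.mem_range]
    rfl
  · rw [← Algebra.map_top]; exact Subalgebra.FG.map φ hft.out
  · haveI : Nonempty U := ⟨⟨_, hU'⟩⟩
    haveI := functionField_isFractionRing_of_isAffineOpen M.X U hU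
    refine IsFractionRing.of_field _ K fun z => ?_
    obtain ⟨a, b, -, hab⟩ :=
      IsFractionRing.div_surjective (A := Γ(M.X, U)) (M.funFieldIso.inv.hom z)
    refine ⟨⟨φ a, a, rfl⟩, ⟨φ b, b, rfl⟩, ?_⟩
    change z = sec a / sec b
    have h : M.funFieldIso.hom.hom (M.funFieldIso.inv.hom z) = z := by
      rw [← CommRingCat.comp_apply, Iso.inv_hom_id, CommRingCat.id_apply]
    rw [← hab, map_div₀] at h
    exact h.symm

/-! ## Lifts `Spec 𝒪_v → M` of the `K`-point: `𝒪_v` dominates `𝒪_{M, l(𝔪_v)}` -/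

section Lift

variable {M : ProperModel k K} (v : ZariskiRiemannSpace k K)
  (l : Spec (CommRingCat.of v.asValuationSubring) ⟶ M.X) (hl : KModel.specKTo v ≫ l = M.gen)

include hl

/-- **For a lift `l : Spec 𝒪_v → M` of the `K`-point, the local homomorphism
`𝒪_{M, l(𝔪_v)} → 𝒪_v` followed by `𝒪_v ⊆ K` is `𝒪_{M, l(𝔪_v)} → K`.**
[cite: ZariskiSamuel1960, Ch. VI §17] -/
theorem centreChart_stalkClosedPointTo_comp :
    Scheme.stalkClosedPointTo l ≫ CommRingCat.ofHom (algebraMap v.asValuationSubring K) =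
      M.X.presheaf.stalkSpecializes
          (genericPoint_specializes (l (closedPoint v.asValuationSubring))) ≫ M.funFieldIso.hom := by
  -- adapted from `ProjModel.isCentreOf_of_lift` (ProjectiveModelsCentresLocal.lean)
  apply centreChart_eq_stalkToK_of_specMap_comp
  rw [Spec.map_comp, Category.assoc, Scheme.Spec_stalkClosedPointTo_fromSpecStalk]
  exact hl

/-- Pointwise form: the value in `K` of the image in `𝒪_v` of `t ∈ 𝒪_{M, l(𝔪_v)}` is the image
of `t` in `K`. [folklore] -/
theorem centreChart_coe_stalkClosedPointTo
    (t : M.X.presheaf.stalk (l (closedPoint v.asValuationSubring))) :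
    ((Scheme.stalkClosedPointTo l).hom t : K) =
      (M.X.presheaf.stalkSpecializes
          (genericPoint_specializes (l (closedPoint v.asValuationSubring))) ≫
        M.funFieldIso.hom).hom t := by
  rw [← centreChart_stalkClosedPointTo_comp v l hl]; rfl

/-- **`𝒪_{M, l(𝔪_v)} ⊆ 𝒪_v` inside `K`.** [cite: ZariskiSamuel1960, Ch. VI §17] -/
theorem centreChart_stalkToK_mem_of_lift
    (t : M.X.presheaf.stalk (l (closedPoint v.asValuationSubring))) :
    (M.X.presheaf.stalkSpecializes
          (genericPoint_specializes (l (closedPoint v.asValuationSubring))) ≫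
        M.funFieldIso.hom).hom t ∈ v.asValuationSubring := by
  rw [← centreChart_coe_stalkClosedPointTo v l hl t]
  exact ((Scheme.stalkClosedPointTo l).hom t).2

/-- **Domination**: an element of `𝒪_{M, l(𝔪_v)}` whose image in `K` is a unit of `𝒪_v` is a
unit (the induced `𝒪_{M, l(𝔪_v)} → 𝒪_v` is a local homomorphism).
[cite: ZariskiSamuel1960, Ch. VI §17] -/
theorem centreChart_isUnit_of_lift {t : M.X.presheaf.stalk (l (closedPoint v.asValuationSubring))}
    (h0 : (M.X.presheaf.stalkSpecializes
          (genericPoint_specializes (l (closedPoint v.asValuationSubring))) ≫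
        M.funFieldIso.hom).hom t ≠ 0)
    (hinv : ((M.X.presheaf.stalkSpecializes
          (genericPoint_specializes (l (closedPoint v.asValuationSubring))) ≫
        M.funFieldIso.hom).hom t)⁻¹ ∈ v.asValuationSubring) :
    IsUnit t := by
  have hval := centreChart_coe_stalkClosedPointTo v l hl t
  have hu : IsUnit ((Scheme.stalkClosedPointTo l).hom t) :=
    isUnit_of_inv_mem v.asValuationSubring ((Scheme.stalkClosedPointTo l).hom t).2
      (by rw [hval]; exact hinv) (by rw [hval]; exact h0)
  exact (isUnit_map_iff (Scheme.stalkClosedPointTo l).hom t).mp hu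

/-- The inverse in `K` of the image of a unit of `𝒪_{M, l(𝔪_v)}` lies in `𝒪_v`. [folklore] -/
theorem centreChart_inv_stalkToK_mem_of_isUnit
    {t : M.X.presheaf.stalk (l (closedPoint v.asValuationSubring))} (ht : IsUnit t) :
    ((M.X.presheaf.stalkSpecializes
          (genericPoint_specializes (l (closedPoint v.asValuationSubring))) ≫
        M.funFieldIso.hom).hom t)⁻¹ ∈ v.asValuationSubring := by
  obtain ⟨w, rfl⟩ := ht
  rw [← map_units_inv]
  exact centreChart_stalkToK_mem_of_lift v l hl _

/-- **The image in `K` of the sections of an open through `l(𝔪_v)` lies in `𝒪_v`.**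
[cite: ZariskiSamuel1960, Ch. VI §17] -/
theorem centreChart_secRange_le_of_lift {U : M.X.Opens} {x : M.X} (hx : x ∈ U)
    (hlx : l (closedPoint v.asValuationSubring) = x) :
    (M.X.presheaf.germ U (genericPoint M.X) (centreChart_genericPoint_mem hx) ≫
        M.funFieldIso.hom).hom.range ≤ v.asValuationSubring.toSubring := by
  subst hlx
  rintro _ ⟨f, rfl⟩
  change _ ∈ v.asValuationSubring
  rw [← centreChart_stalkToK_germ M hx]
  exact centreChart_stalkToK_mem_of_lift v l hl _

end Lift

end Model

/-! ## The image of `𝒪_{M,x}` in `K` is the localisation of the chart at the centre -/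

section LocAt

variable {k K : Type} [Field k] [Field K] [Algebra k K]
variable {M : ProperModel k K} (v : ZariskiRiemannSpace k K)
  (l : Spec (CommRingCat.of v.asValuationSubring) ⟶ M.X) (hl : KModel.specKTo v ≫ l = M.gen)

include hl in
/-- **The image of `𝒪_{M,x}` in `K` is `locAt 𝒪_v A = A_{𝔪_v ∩ A}`** for the chart `A` (any
`k`-subalgebra of `K` whose subring is the image of `Γ(M, U)`) of an affine open
`U ∋ x = l(𝔪_v)`: `𝒪_{M,x}` is the localisation of `Γ(M, U)` at the prime of `x`
(`IsAffineOpen.isLocalization_stalk`), so its elements are `a / s` with `s` a unit of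
`𝒪_{M,x}`, i.e. (domination) with `s` a unit of `𝒪_v`; conversely such fractions lie in the
image. [cite: ZariskiSamuel1960, Ch. VI §17] -/
theorem centreChart_locAt_toSubring_eq_of_lift {U : M.X.Opens} (hU : IsAffineOpen U) {x : M.X}
    (hx : x ∈ U) (hlx : l (closedPoint v.asValuationSubring) = x) (A : Subalgebra k K)
    (hA : A.toSubring = (M.X.presheaf.germ U (genericPoint M.X) (centreChart_genericPoint_mem hx) ≫
      M.funFieldIso.hom).hom.range) :
    (locAt v.asValuationSubring A).toSubring =
      (M.X.presheaf.stalkSpecializes (genericPoint_specializes x) ≫ M.funFieldIso.hom).hom.range := by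
  subst hlx
  set toK := (M.X.presheaf.stalkSpecializes
    (genericPoint_specializes (l (closedPoint v.asValuationSubring))) ≫ M.funFieldIso.hom).hom
    with htoK
  set sec := (M.X.presheaf.germ U (genericPoint M.X) (centreChart_genericPoint_mem hx) ≫
    M.funFieldIso.hom).hom with hsec
  have hmem : ∀ y, y ∈ A ↔ ∃ f, sec f = y := fun y => by
    rw [← Subalgebra.mem_toSubring, hA]; exact RingHom.mem_range
  have hgerm : ∀ f, toK ((M.X.presheaf.germ U _ hx).hom f) = sec f :=
    centreChart_stalkToK_germ M hx
  apply le_antisymm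
  · -- `locAt 𝒪_v A ⊆ im 𝒪_{M,x}`: generators `a * s⁻¹`, `s⁻¹ ∈ 𝒪_v`, have `s` a unit upstairs
    let R : Subalgebra k K :=
      { toK.range with
        algebraMap_mem' := fun c => ⟨(M.X.presheaf.germ U _ hx).hom
          ((M.π.appLE ⊤ U le_top).hom ((Scheme.ΓSpecIso (.of k)).inv.hom c)), by
            rw [hgerm, centreChart_secToK_algebraMap]⟩ }
    have hle : locAt v.asValuationSubring A ≤ R := by
      refine Algebra.adjoin_le ?_
      rintro _ ⟨a, ha, s, hs, hsO, rfl⟩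
      obtain ⟨a', rfl⟩ := (hmem _).mp ha
      obtain ⟨s', rfl⟩ := (hmem _).mp hs
      change sec a' * (sec s')⁻¹ ∈ toK.range
      by_cases h0 : sec s' = 0
      · rw [h0, inv_zero, mul_zero]; exact Subring.zero_mem _
      · rw [← hgerm] at h0 hsO ⊢
        rw [← hgerm s']
        obtain ⟨w, hw⟩ := centreChart_isUnit_of_lift v l hl h0 hsO
        refine ⟨(M.X.presheaf.germ U _ hx).hom a' * ↑w⁻¹, ?_⟩
        rw [map_mul, map_units_inv, hw]
    exact fun z hz => hle hz
  · -- `im 𝒪_{M,x} ⊆ locAt 𝒪_v A`: `t = a / s` with `s ∉ 𝔭_x`, a unit of `𝒪_{M,x}`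
    rintro _ ⟨t, rfl⟩
    letI : Algebra Γ(M.X, U) (M.X.presheaf.stalk (l (closedPoint v.asValuationSubring))) :=
      (M.X.presheaf.germ U _ hx).hom.toAlgebra
    haveI : IsLocalization.AtPrime (M.X.presheaf.stalk (l (closedPoint v.asValuationSubring)))
        (hU.primeIdealOf ⟨_, hx⟩).asIdeal :=
      hU.isLocalization_stalk ⟨_, hx⟩
    obtain ⟨⟨a, s⟩, hts⟩ := IsLocalization.surj (hU.primeIdealOf ⟨_, hx⟩).asIdeal.primeCompl t
    have hsu : IsUnit ((M.X.presheaf.germ U _ hx).hom (s : Γ(M.X, U))) :=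
      IsLocalization.map_units (M.X.presheaf.stalk (l (closedPoint v.asValuationSubring))) s
    have hts' : t * (M.X.presheaf.germ U _ hx).hom (s : Γ(M.X, U)) =
        (M.X.presheaf.germ U _ hx).hom a := hts
    have hne : toK ((M.X.presheaf.germ U _ hx).hom (s : Γ(M.X, U))) ≠ 0 :=
      (hsu.map toK).ne_zero
    have key : toK t = sec a * (sec s)⁻¹ := by
      rw [← hgerm, ← hgerm, eq_mul_inv_iff_mul_eq₀ hne, ← map_mul, hts']
    rw [Subalgebra.mem_toSubring, key]
    refine mul_inv_mem_locAt v.asValuationSubring A ((hmem _).mpr ⟨a, rfl⟩)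
      ((hmem _).mpr ⟨_, rfl⟩) ?_
    rw [← hgerm]
    exact centreChart_inv_stalkToK_mem_of_isUnit v l hl hsu

end LocAt

/-! ## The registered stub -/

/-- **STUB `stub_centreChart`.** For a proper model `M` of `K/k`, `v ∈ Zar(K/k)` and an affine
open `U` containing the centre `x` of `v`: the map `𝒪_{M,x} → K(M) ≅ K` is injective; the image
`A ⊆ K` of `Γ(M, U) → 𝒪_{M,x} → K` is (the carrier of) a finitely generated `k`-subalgebra with
`Frac A = K` contained in `𝒪_v`; and the image of `𝒪_{M,x}` is `locAt 𝒪_v A = A_{𝔪_v ∩ A}`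
(the lift `Spec 𝒪_v → M` of the centre factors through `Spec 𝒪_{M,x}`, a local homomorphism,
so `𝒪_v` dominates `𝒪_{M,x} = A_𝔭`). [cite: ZariskiSamuel1960, Ch. VI §17] -/
theorem stub_centreChart : ∀ (k K : Type) [Field k] [Field K] [Algebra k K]
    (M : ProperModel k K) (v : ZariskiRiemannSpace k K) (U : M.X.Opens) (_hU : IsAffineOpen U)
    (hx : M.centre v ∈ U),
    Function.Injective
        ((M.X.presheaf.stalkSpecializes (genericPoint_specializes (M.centre v)) ≫
          M.funFieldIso.hom).hom) ∧
      ∃ A : Subalgebra k K,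
        (A : Set K) = Set.range
          (((M.X.presheaf.stalkSpecializes (genericPoint_specializes (M.centre v)) ≫
              M.funFieldIso.hom).hom).comp (M.X.presheaf.germ U (M.centre v) hx).hom) ∧
        A.FG ∧ IsFractionRing ↥A K ∧ A.toSubring ≤ v.asValuationSubring.toSubring ∧
        (locAt v.asValuationSubring A).toSubring =
          ((M.X.presheaf.stalkSpecializes (genericPoint_specializes (M.centre v)) ≫
            M.funFieldIso.hom).hom).range := by
  intro k K _ _ _ M v U hU hx
  obtain ⟨l, hl, -, hlx⟩ := M.isCentre_centre v
  obtain ⟨A, hA, hfg, hfr⟩ := centreChart_exists_subalgebra M hU (centreChart_genericPoint_mem hx)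
  refine ⟨centreChart_stalkToK_injective M (M.centre v), A, ?_, hfg, hfr, ?_,
    centreChart_locAt_toSubring_eq_of_lift v l hl hU hx hlx A hA⟩
  · rw [← Subalgebra.coe_toSubring, hA, RingHom.coe_range]
    ext z
    constructor
    · rintro ⟨f, rfl⟩
      exact ⟨f, centreChart_stalkToK_germ M hx f⟩
    · rintro ⟨f, rfl⟩
      exact ⟨f, (centreChart_stalkToK_germ M hx f).symm⟩
  · rw [hA]; exact centreChart_secRange_le_of_lift v l hl hx hlx

end Summit.ResolutionOfSingularities.ResolutionOfSingularities.Theorems.SyzygyFlattening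

end
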